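import Literature.Geometry.Kaehler.ComplexTorusWeylOperatorPolarizationIsometry
import HarnessLib

/-!
# André's Proposition 1.2 for the Weyl pairing: TRANSPOSITION FOR `(x, y) ↦ ∫_X w(x) ∧ y` IS MATRIX TRANSPOSITION IN THE LEFSCHETZ `SL₂` —
# `B(Lx, y) = −B(x, Λy)`, `B(Λx, y) = −B(x, Ly)`, `B(wx, y) = B(x, wy)`; for Voisin's `Q_w`: `Lᵀ = Λ`, `Λᵀ = L`, `wᵀ = w⁻¹`

Layer `Literature/Geometry/Kaehler`, namespace `Literature.Geometry.Kaehler.ComplexTorus`; lane `lit-hodgefound` (Track 2 foundations library, Layer A4), sequel of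
`ComplexTorusWeylOperatorPolarization` (the Weyl pairing `B_k = weylPairing`, the `ℚ`-form `Q_w = weylPolarizationForm = (−1)^{k(k−1)/2} B_k` on `Hᵏ(X, ℚ)`) and
`ComplexTorusWeylOperatorPolarizationIsometry` (`Q_w(wx, wy) = Q_w(x, y)`). THEOREMS ONLY (no definition, no named fact; net debt `0`). Consumed by name: p09's
`weylOperator_mul_e` / `weylOperator_mul_dual` (`w L = −Λ w`, `w Λ = −L w` in `End H•(X; ℂ)`), `poincarePairing_lefschetzPow_one_comm`, `poincarePairing_lefschetzDual_comm_of_nondegenerate`,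
`poincarePairing_weylOperator_comm` (`L`, `Λ`, `w` are self-adjoint for the cup-product pairing), `lefschetzDual_mem_rationalForms` (`Λ` is defined over `ℚ`).

WHAT IS HERE (`X = E/Λ` a complex torus, `g = dim_ℂ E`, `e : Fin (2g) ≃ ι`, `η` a non-degenerate real `2`-form, `(L, H, Λ)` its Lefschetz `𝔰𝔩₂`-triple on `H•(X; ℂ)`
(`lefschetzPow η 1`, `countingG`, `lefschetzDual η`), `w` the Weyl element).
* §1 `w(Lx)_{t'} = −Λ(w(x)_{t'+2})` and `w(Λx)_{t+2} = −L(w(x)_t)` on homogeneous components (`weylOperator_of_lefschetzPow_one_apply`, `weylOperator_of_lefschetzDual_apply`).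
* §2 for the Weyl pairing `B(x, y) = ∫_X w(x) ∧ y` (pairs `Hᵏ` with `Hᵏ`): **`B(Lx, y) = −B(x, Λy)`** (`weylPairing_lefschetzPow_one_left`), **`B(Λx, y) = −B(x, Ly)`**
  (`weylPairing_lefschetzDual_left`), **`B(w(x)_t, y) = B(x, w(y)_k)`** (`weylPairing_weylOperator_left`): the transposes of `L`, `Λ`, `w` for `B` are `−Λ`, `−L`, `w`
  (`H = deg − g` is trivially self-adjoint, `B` pairing equal degrees).
* §3 for Voisin's normalisation `Q_w^{(k)} = (−1)^{k(k−1)/2} B_k` on `H•(X, ℚ)` (`η ∈ NS(X)`), where `(−1)^{(a+2)(a+1)/2} = −(−1)^{a(a−1)/2}` absorbs the signs: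
  **`Q_w(Lx, y) = Q_w(x, Λy)`**, **`Q_w(Λx, y) = Q_w(x, Ly)`**, **`Q_w(wx, y) = Q_w(x, w⁻¹y)`** (`IsNSForm.weylPolarizationForm_ratLefschetzPow_one_left`, `…_lefschetzDual_left`,
  `weylPolarizationForm_ratWeylOperator_left` / `'`): TRANSPOSITION FOR `Q_w` IS MATRIX TRANSPOSITION — `(0 0; 1 0) ↔ (0 1; 0 0)`, `(0 −1; 1 0) ↦ (0 −1; 1 0)ᵀ = (0 −1; 1 0)⁻¹` —
  André's Proposition 1.2 for `* = *_H` on a complex torus, in the tree's normalisations.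
* §4 (appended, row g48-#9) **THE LEFSCHETZ–KÜNNETH PROJECTORS ARE SELF-ADJOINT FOR `B` AND `Q_w`**: `B(π_{s,r} x, y) = B(x, π_{s,r} y)` in every degree `s ≤ 2g`
  (`weylPairing_primitiveProj_left`; Kleiman's `π_{s,r} = primitiveProj η s r`, the cohomological realisation of Künnemann's `e_{s,r}`: `w π_{s,r} = π_{t,r'} w` and
  `π` is Poincaré-adjoint to its partner `π`, `ComplexTorusWeylOperatorLefschetzProjectors`, `ComplexTorusPrimitiveProjectorsPoincareAdjoint`), hence
  `Q_w(π_{s,r} x, y) = Q_w(x, π_{s,r} y)` on `Hˢ(X, ℚ)` (`IsNSForm.weylPolarizationForm_primitiveProj_left`) — André: the algebra `ℚ[L, ᶜΛ]` "contient les projecteurs de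
  Künneth", and its idempotents `π_{s,r}` are symmetric for the transposition of Prop. 1.2.

SOURCES (quoted from the materialised pages).
* Y. André, *Pour une théorie inconditionnelle des motifs*, Publ. Math. IHÉS 83 (1996), held `paper:doi-10-1007-bf02698643`, §1.1 (p0008 L13–L14): "Remarquons aussi que `L`, `*_L`,
  `*_H` et `ᶜΛ` sont auto-adjoints relativement à l'accouplement de dualité de Poincaré `(x, y) ↦ ∫ x ∪ y`"; §1.2 (p0008 L38–L41): "Alors `(ᶜΛ, h, −L)` forme un
  `𝔰𝔩₂`-triplet au sens de Bourbaki, Lie VIII 11.1 […] On en déduit une représentation de `sl₂` sur `H•(X)`"; (p0008 L54–L55) "l'élément `(0 1 ; −1 0)` de `SL₂` s'envoie sur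
  `± *_H`"; Prop. 1.2 (p0008 L62–L66): "Les sous-algèbres `ℚ[L, *_L]`, `ℚ[L, *_H]`, `ℚ[L, ᶜL, *_L]`, `ℚ[L, ᶜΛ]` de `End H(X)` sont égales et contiennent les projecteurs de
  Künneth. De plus, ces algèbres sont canoniquement isomorphes à une somme d'algèbres matricielles […]. Via cet isomorphisme, la transposition relative à la forme
  bilinéaire `(x, y) ↦ ∫ x ∪ *y` correspond à la transposition des matrices, pour `* = *_L` ou `*_H`."
* D. Huybrechts, *Complex Geometry* (2005), §1.2 Def. 1.2.21, Lemma 1.2.23 (`Λ` is the formal adjoint of `L`); C. Voisin, *Hodge Theory and Complex Algebraic Geometry I*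
  (CUP 2002), §7.1.2 Def. 7.7 (PDF p. 134); E. Looijenga, V. Lunts, Invent. Math. 129 (1997), §1 (1.7); A. Beauville, *The action of `SL₂` on abelian varieties* (2010),
  §4 Theorem; H. Lange, *Abelian Varieties over the Complex Numbers* (2023), §6.2.4 Prop. 6.2.20 (p. 310).

## References

* [Andre1996Motifs] Y. André, Pour une théorie inconditionnelle des motifs, Publ. Math. IHÉS 83 (1996) — §1.1, §1.2, Prop. 1.2 (p. 11).
* [Huybrechts2005] D. Huybrechts, Complex Geometry. An Introduction, Springer 2005 — §1.2 Def. 1.2.21, Lemma 1.2.23.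
* [VoisinHodgeI2002] C. Voisin, Hodge Theory and Complex Algebraic Geometry I, CUP 2002 — §7.1.2 Def. 7.7 (PDF p. 134).
* [LooijengaLunts1997] E. Looijenga, V. Lunts, A Lie algebra attached to a projective variety, Invent. Math. 129 (1997) — §1 (1.7).
* [Beauville2010SL2] A. Beauville, The action of SL₂ on abelian varieties, J. Ramanujan Math. Soc. 25 (2010) — §4 Theorem.
* [Lange2023AbelianVarietiesComplex] H. Lange, Abelian Varieties over the Complex Numbers, Springer 2023 — §6.2.4 Prop. 6.2.20.
* [Kleiman1968AlgebraicCycles] S. L. Kleiman, Algebraic cycles and the Weil conjectures, in: Dix exposés sur la cohomologie des schémas, North-Holland 1968 — §1.4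
  (the projectors `π` as polynomials in `L`, `Λ`).
-/

noncomputable section

-- `Module ℂ` / `SMulZeroClass ℂ` synthesis on `E [⋀^Fin k]→L[ℝ] ℂ` (as in `ComplexTorusLefschetzDecomposition`)
set_option maxSynthPendingDepth 3

namespace Literature.Geometry.Kaehler

namespace ComplexTorus

open Module Function Finset Complex
open Literature.LinearAlgebra.Alternating Literature.Algebra.Lie Literature.Analysis.Complex

universe uE

variable {ι : Type*} [Fintype ι] [DecidableEq ι] {E : Type uE} [NormedAddCommGroup E] [NormedSpace ℂ E] [FiniteDimensional ℂ E] [Nontrivial E]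
  (Φ : (ι → ℝ) ≃L[ℝ] E) {η : E [⋀^Fin 2]→L[ℝ] ℝ} (hη : ∀ v : E, v ≠ 0 → ∃ w : E, η ![v, w] ≠ 0)

/-! ## §0 Bookkeeping: `B_k(x, y) = sign(e) · ⟨w(x)_t, y⟩` -/

section Bridge

omit [Fintype ι] [FiniteDimensional ℂ E] [Nontrivial E] in
/-- `∫_X` along a frame re-read in another degree is `∫_X` of the re-read form. [folklore] -/
private theorem torusIntegral_finCongr_trans₅₂ {M N : ℕ} (h : M = N) (e : Fin N ≃ ι) (θ : E [⋀^Fin M]→L[ℝ] ℂ) :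
    torusIntegral Φ ((finCongr h).trans e) θ = torusIntegral Φ e (θ.domDomCongr (finCongr h)) := by
  subst h
  rfl

omit [Fintype ι] [FiniteDimensional ℂ E] [Nontrivial E] in
/-- `sign((finCongr h).trans e) = sign(e)`. [folklore] -/
private theorem orientationSign_finCongr_trans₅₂ {M N : ℕ} (h : M = N) (e : Fin N ≃ ι) :
    orientationSign Φ ((finCongr h).trans e) = orientationSign Φ e := by
  subst h
  rfl

omit [Fintype ι] in
/-- `B_k(x, y) = sign(e) · ⟨w(x)_t, y⟩_{e}` (the Weyl pairing through the cup-product pairing `poincarePairing`). [cite: Lange2023AbelianVarietiesComplex, §6.2.4 (p. 310)] -/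
private theorem weylPairing_eq_sign_mul_poincarePairing₅₂ {N : ℕ} (e : Fin N ≃ ι) {k t : ℕ} (htk : t + k = N) (x y : E [⋀^Fin k]→L[ℝ] ℂ) :
    weylPairing Φ hη e htk x y =
      orientationSign Φ e * poincarePairing Φ e htk ((hasLefschetzProperty_lefschetzG hη).weylOperator isZGrading_countingG (GForm.of k x) t) y := by
  rw [weylPairing_apply, ← torusIntegral_finCongr_trans₅₂, torusIntegral_wedge_eq_orientationSign_mul_poincarePairing, orientationSign_finCongr_trans₅₂]

end Bridge

/-! ## §1 `w L = −Λ w` and `w Λ = −L w`, degree by degree -/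

section Operators

include hη in
/-- **`w(L x)_{t'} = −Λ (w(x)_{t'+2})`** for `x ∈ Hᵃ`, `t' + a + 2 = 2g`: the Weyl element conjugates `L` into `−Λ` (p09's `weylOperator_mul_e`: `w ∘ L = −Λ ∘ w` on
`H•(X; ℂ)`), read on homogeneous components. [cite: Andre1996Motifs, §1.2 (p. 11)] [cite: LooijengaLunts1997, §1 (1.7)] -/
theorem weylOperator_of_lefschetzPow_one_apply {a t' : ℕ} (h : t' + (a + 2) = 2 * finrank ℂ E) (x : E [⋀^Fin a]→L[ℝ] ℂ) :
    (hasLefschetzProperty_lefschetzG hη).weylOperator isZGrading_countingG (GForm.of (a + 2) (lefschetzPow η 1 (show 2 * 1 + a = a + 2 by omega) x)) t' =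
      -lefschetzDual η t' ((hasLefschetzProperty_lefschetzG hη).weylOperator isZGrading_countingG (GForm.of a x) (t' + 2)) := by
  have h1 := LinearMap.congr_fun ((hasLefschetzProperty_lefschetzG hη).weylOperator_mul_e isZGrading_countingG) (GForm.of a x)
  rw [Module.End.mul_apply, LinearMap.neg_apply, Module.End.mul_apply, lefschetzG_of, dual_lefschetzG_eq_lefschetzDualG hη,
    weylOperator_of_eq_of hη (show a + (t' + 2) = 2 * finrank ℂ E by omega) x, lefschetzDualG_of_add_two] at h1
  have h2 := congrFun h1 t'
  rwa [Pi.neg_apply, GForm.of_apply_self] at h2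

include hη in
/-- **`w(Λ x)_{t+2} = −L (w(x)_t)`** for `x ∈ H^{a+2}`, `t + a + 2 = 2g` (p09's `weylOperator_mul_dual`: `w ∘ Λ = −L ∘ w`). [cite: Andre1996Motifs, §1.2 (p. 11)]
[cite: LooijengaLunts1997, §1 (1.7)] -/
theorem weylOperator_of_lefschetzDual_apply {a t : ℕ} (h : t + (a + 2) = 2 * finrank ℂ E) (x : E [⋀^Fin (a + 2)]→L[ℝ] ℂ) :
    (hasLefschetzProperty_lefschetzG hη).weylOperator isZGrading_countingG (GForm.of a (lefschetzDual η a x)) (t + 2) =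
      -lefschetzPow η 1 (show 2 * 1 + t = t + 2 by omega) ((hasLefschetzProperty_lefschetzG hη).weylOperator isZGrading_countingG (GForm.of (a + 2) x) t) := by
  have h1 := LinearMap.congr_fun ((hasLefschetzProperty_lefschetzG hη).weylOperator_mul_dual isZGrading_countingG) (GForm.of (a + 2) x)
  rw [Module.End.mul_apply, LinearMap.neg_apply, Module.End.mul_apply, dual_lefschetzG_eq_lefschetzDualG hη, lefschetzDualG_of_add_two,
    weylOperator_of_eq_of hη (show (a + 2) + t = 2 * finrank ℂ E by omega) x, lefschetzG_of] at h1
  have h2 := congrFun h1 (t + 2)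
  rwa [Pi.neg_apply, GForm.of_apply_self] at h2

end Operators

/-! ## §2 Transposition for the Weyl pairing `B(x, y) = ∫_X w(x) ∧ y`: `Lᵀ = −Λ`, `Λᵀ = −L`, `wᵀ = w` -/

section Transposition

include hη in
/-- **`B(L x, y) = −B(x, Λ y)`** for `x ∈ Hᵃ(X; ℂ)`, `y ∈ H^{a+2}(X; ℂ)` (`B = weylPairing`, in degrees `a + 2` and `a`): the TRANSPOSE OF `L` FOR THE WEYL PAIRING IS `−Λ` —
`w L = −Λ w` and `Λ` is self-adjoint for the cup-product pairing ("`L`, `*_L`, `*_H` et `ᶜΛ` sont auto-adjoints relativement à l'accouplement de dualité de Poincaré");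
André's Prop. 1.2: "la transposition relative à la forme bilinéaire `(x, y) ↦ ∫ x ∪ *y` correspond à la transposition des matrices" (the sign is that of the tree's
triple `(L, H, Λ)` against André's `sl₂`-triplet `(ᶜΛ, h, −L)`; it disappears for Voisin's normalisation `Q_w`, §3). [cite: Andre1996Motifs, §1.1 (p. 11), §1.2 Prop. 1.2 (p. 11)]
[cite: Huybrechts2005, §1.2 Lemma 1.2.23] -/
theorem weylPairing_lefschetzPow_one_left {g : ℕ} (e : Fin (2 * g) ≃ ι) {a t' : ℕ} (ht' : t' + (a + 2) = 2 * g) (ht : t' + 2 + a = 2 * g)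
    (x : E [⋀^Fin a]→L[ℝ] ℂ) (y : E [⋀^Fin (a + 2)]→L[ℝ] ℂ) :
    weylPairing Φ hη e ht' (lefschetzPow η 1 (show 2 * 1 + a = a + 2 by omega) x) y = -weylPairing Φ hη e ht x (lefschetzDual η a y) := by
  have hg : finrank ℂ E = g := finrank_eq_of_finTwoMulEquiv Φ e
  rw [weylPairing_eq_sign_mul_poincarePairing₅₂, weylPairing_eq_sign_mul_poincarePairing₅₂, weylOperator_of_lefschetzPow_one_apply hη (by omega) x, map_neg,
    LinearMap.neg_apply, poincarePairing_lefschetzDual_comm_of_nondegenerate Φ hη e ht' ht, mul_neg]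

include hη in
/-- **`B(Λ x, y) = −B(x, L y)`** for `x ∈ H^{a+2}(X; ℂ)`, `y ∈ Hᵃ(X; ℂ)`: the transpose of `Λ` for the Weyl pairing is `−L` (`w Λ = −L w`, `L` self-adjoint for the cup product).
[cite: Andre1996Motifs, §1.1 (p. 11), §1.2 Prop. 1.2 (p. 11)] [cite: Huybrechts2005, §1.2 Lemma 1.2.23] -/
theorem weylPairing_lefschetzDual_left {g : ℕ} (e : Fin (2 * g) ≃ ι) {a t : ℕ} (ht : t + (a + 2) = 2 * g) (ht2 : t + 2 + a = 2 * g)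
    (x : E [⋀^Fin (a + 2)]→L[ℝ] ℂ) (y : E [⋀^Fin a]→L[ℝ] ℂ) :
    weylPairing Φ hη e ht2 (lefschetzDual η a x) y = -weylPairing Φ hη e ht x (lefschetzPow η 1 (show 2 * 1 + a = a + 2 by omega) y) := by
  have hg : finrank ℂ E = g := finrank_eq_of_finTwoMulEquiv Φ e
  rw [weylPairing_eq_sign_mul_poincarePairing₅₂, weylPairing_eq_sign_mul_poincarePairing₅₂, weylOperator_of_lefschetzDual_apply hη (by omega) x, map_neg,
    LinearMap.neg_apply, poincarePairing_lefschetzPow_one_comm Φ η e ht2 ht, mul_neg]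

include hη in
/-- `w(w(x)_t)_k = (−1)^{|k−g|} x` on `Hᵏ` (`w² = (−1)^{k−g}`, the centre of `SL₂`). [cite: Andre1996Motifs, §1.2 (p. 11)] [cite: Beauville2010SL2, §4 Theorem] -/
private theorem weylOperator_of_weylOperator_of₅₂ {g k t : ℕ} (hg : finrank ℂ E = g) (hkt : k + t = 2 * g) (x : E [⋀^Fin k]→L[ℝ] ℂ) :
    (hasLefschetzProperty_lefschetzG hη).weylOperator isZGrading_countingG
        (GForm.of t ((hasLefschetzProperty_lefschetzG hη).weylOperator isZGrading_countingG (GForm.of k x) t)) k = ((-1 : ℂ) ^ ((k : ℤ) - (g : ℤ)).natAbs) • x := by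
  rw [← weylOperator_of_eq_of hη (show k + t = 2 * finrank ℂ E by omega) x,
    (hasLefschetzProperty_lefschetzG hη).weylOperator_weylOperator_apply_of_mem isZGrading_countingG (of_mem_degreeSpace_countingG (E := E) k x),
    Pi.smul_apply, GForm.of_apply_self, hg]

include hη in
/-- **`B(w(x)_t, y) = B(x, w(y)_k)`** for `x ∈ Hᵏ`, `y ∈ Hᵗ`, `t + k = 2g` (`B` in degrees `t` and `k`): the Weyl element is SELF-ADJOINT for the Weyl pairing — both sides are
`(−1)^{|k−g|} sign(e) ⟨x, y⟩` (`w² = (−1)^{k−g}` and "`*_H` […] auto-adjoint" for the cup product). [cite: Andre1996Motifs, §1.1 (p. 11), §1.2 Prop. 1.2 (p. 11)]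
[cite: Lange2023AbelianVarietiesComplex, §6.2.4 Prop. 6.2.20 (p. 310)] -/
theorem weylPairing_weylOperator_left {g : ℕ} (e : Fin (2 * g) ≃ ι) {k t : ℕ} (htk : t + k = 2 * g) (hkt : k + t = 2 * g) (x : E [⋀^Fin k]→L[ℝ] ℂ)
    (y : E [⋀^Fin t]→L[ℝ] ℂ) :
    weylPairing Φ hη e hkt ((hasLefschetzProperty_lefschetzG hη).weylOperator isZGrading_countingG (GForm.of k x) t) y =
      weylPairing Φ hη e htk x ((hasLefschetzProperty_lefschetzG hη).weylOperator isZGrading_countingG (GForm.of t y) k) := by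
  have hg : finrank ℂ E = g := finrank_eq_of_finTwoMulEquiv Φ e
  rw [weylPairing_eq_sign_mul_poincarePairing₅₂, weylPairing_eq_sign_mul_poincarePairing₅₂, weylOperator_of_weylOperator_of₅₂ hη hg hkt x,
    poincarePairing_weylOperator_comm Φ hη e htk hkt x _, weylOperator_of_weylOperator_of₅₂ hη hg htk y, map_smul, LinearMap.smul_apply, map_smul, smul_eq_mul,
    smul_eq_mul, show ((t : ℤ) - (g : ℤ)).natAbs = ((k : ℤ) - (g : ℤ)).natAbs by omega]

end Transposition

/-! ## §3 Transposition for Voisin's normalisation `Q_w = (−1)^{k(k−1)/2} B` on `H•(X, ℚ)`: `Lᵀ = Λ`, `Λᵀ = L`, `wᵀ = w⁻¹` — matrix transposition exactly -/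

section Rational

omit [Fintype ι] [DecidableEq ι] [NormedAddCommGroup E] [NormedSpace ℂ E] [FiniteDimensional ℂ E] [Nontrivial E] in
/-- `(−1)^{(a+2)(a+1)/2} = −(−1)^{a(a−1)/2}` (`(a+2)(a+1)/2 = a(a−1)/2 + 2a + 1`). [folklore] -/
private theorem neg_one_pow_half_succ_succ₅₂ (a : ℕ) : (-1 : ℂ) ^ ((a + 2) * (a + 2 - 1) / 2) = -(-1) ^ (a * (a - 1) / 2) := by
  have h : (a + 2) * (a + 2 - 1) / 2 = a * (a - 1) / 2 + (2 * a + 1) := by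
    rcases a with _ | b
    · rfl
    · have e1 : b + 1 + 2 - 1 = b + 2 := by omega
      have e2 : b + 1 - 1 = b := by omega
      rw [e1, e2, show (b + 1 + 2) * (b + 2) = (b + 1) * b + 2 * (2 * (b + 1) + 1) by ring, Nat.add_mul_div_left _ _ two_pos]
  rw [h, pow_add, (show Odd (2 * a + 1) from ⟨a, rfl⟩).neg_one_pow, mul_neg, mul_one]

/-- **`Q_w(L x, y) = Q_w(x, Λ y)` ON `H•(X, ℚ)` — THE TRANSPOSE OF `L` FOR THE WEYL POLARIZATION FORM IS `Λ`** (`η ∈ NS(X)` non-degenerate; `x ∈ Hᵃ(X, ℚ)`,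
`y ∈ H^{a+2}(X, ℚ)`, `L = ratLefschetzPow … 1`, `Λ y ∈ Hᵃ(X, ℚ)` by `lefschetzDual_mem_rationalForms`): Voisin's signs `(−1)^{(a+2)(a+1)/2} = −(−1)^{a(a−1)/2}` absorb the
sign of §2 — André's Prop. 1.2 "la transposition relative à la forme bilinéaire `(x, y) ↦ ∫ x ∪ *y` correspond à la transposition des matrices" with the matrices
`L ↦ (0 0; 1 0)`, `Λ ↦ (0 1; 0 0)` transposed into each other. [cite: Andre1996Motifs, §1.2 Prop. 1.2 (p. 11)] [cite: VoisinHodgeI2002, §7.1.2 Def. 7.7 (PDF p. 134)] -/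
theorem IsNSForm.weylPolarizationForm_ratLefschetzPow_one_left (hNS : IsNSForm Φ η) (hη : ∀ v : E, v ≠ 0 → ∃ w : E, η ![v, w] ≠ 0) {g : ℕ} (e : Fin (2 * g) ≃ ι)
    {a t' : ℕ} (ht' : t' + (a + 2) = 2 * g) (ht : t' + 2 + a = 2 * g) (x : rationalForms Φ a) (y : rationalForms Φ (a + 2)) :
    weylPolarizationForm Φ (mem_neronSeveriQ_of_isNSForm Φ hNS) hη e ht' (ratLefschetzPow Φ (hNS.ofRealForm_mem_rationalForms Φ) 1 (show 2 * 1 + a = a + 2 by omega) x) y =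
      weylPolarizationForm Φ (mem_neronSeveriQ_of_isNSForm Φ hNS) hη e ht x ⟨lefschetzDual η a (y : E [⋀^Fin (a + 2)]→L[ℝ] ℂ), lefschetzDual_mem_rationalForms Φ hNS hη y.2⟩ := by
  apply Rat.cast_injective (α := ℂ)
  rw [coe_weylPolarizationForm, coe_weylPolarizationForm, coe_ratLefschetzPow, weylPairing_lefschetzPow_one_left Φ hη e ht' ht, neg_one_pow_half_succ_succ₅₂,
    neg_mul_neg]

/-- **`Q_w(Λ x, y) = Q_w(x, L y)` on `H•(X, ℚ)`** (`x ∈ H^{a+2}(X, ℚ)`, `y ∈ Hᵃ(X, ℚ)`): the transpose of `Λ` for the Weyl polarization form is `L`.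
[cite: Andre1996Motifs, §1.2 Prop. 1.2 (p. 11)] [cite: VoisinHodgeI2002, §7.1.2 Def. 7.7 (PDF p. 134)] -/
theorem IsNSForm.weylPolarizationForm_lefschetzDual_left (hNS : IsNSForm Φ η) (hη : ∀ v : E, v ≠ 0 → ∃ w : E, η ![v, w] ≠ 0) {g : ℕ} (e : Fin (2 * g) ≃ ι)
    {a t : ℕ} (ht : t + (a + 2) = 2 * g) (ht2 : t + 2 + a = 2 * g) (x : rationalForms Φ (a + 2)) (y : rationalForms Φ a) :
    weylPolarizationForm Φ (mem_neronSeveriQ_of_isNSForm Φ hNS) hη e ht2 ⟨lefschetzDual η a (x : E [⋀^Fin (a + 2)]→L[ℝ] ℂ), lefschetzDual_mem_rationalForms Φ hNS hη x.2⟩ y =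
      weylPolarizationForm Φ (mem_neronSeveriQ_of_isNSForm Φ hNS) hη e ht x (ratLefschetzPow Φ (hNS.ofRealForm_mem_rationalForms Φ) 1 (show 2 * 1 + a = a + 2 by omega) y) := by
  apply Rat.cast_injective (α := ℂ)
  rw [coe_weylPolarizationForm, coe_weylPolarizationForm, coe_ratLefschetzPow, Submodule.coe_mk, weylPairing_lefschetzDual_left Φ hη e ht ht2, neg_one_pow_half_succ_succ₅₂,
    neg_mul, mul_neg]

/-- **`Q_w(w x, y) = Q_w(x, w⁻¹ y)` on `H•(X, ℚ)`** (`x ∈ Hᵏ(X, ℚ)`, `y ∈ Hᵗ(X, ℚ)`, `t + k = 2g`; `w⁻¹ = (−1)^{|k−g|} w` is `(ratWeylOperatorEquiv …).symm`):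
the transpose of the Weyl
element for `Q_w` is its INVERSE — the transposed matrix `(0 −1; 1 0)ᵀ = (0 1; −1 0) = (0 −1; 1 0)⁻¹` (`ComplexTorusWeylOperatorPolarizationIsometry`: `w` is a `Q_w`-isometry).
[cite: Andre1996Motifs, §1.2 Prop. 1.2 (p. 11)] [cite: VoisinHodgeI2002, §7.1.2 Def. 7.7 (PDF p. 134)] -/
theorem weylPolarizationForm_ratWeylOperator_left (hQ : η ∈ neronSeveriQ Φ) (hη : ∀ v : E, v ≠ 0 → ∃ w : E, η ![v, w] ≠ 0) {g : ℕ} (e : Fin (2 * g) ≃ ι) {k t : ℕ}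
    (htk : t + k = 2 * g) (hkt : k + t = 2 * g) (hkt' : k + t = 2 * finrank ℂ E) (x : rationalForms Φ k) (y : rationalForms Φ t) :
    weylPolarizationForm Φ hQ hη e hkt (ratWeylOperator Φ hQ hη k t x) y = weylPolarizationForm Φ hQ hη e htk x ((ratWeylOperatorEquiv Φ hQ hη hkt').symm y) := by
  set z := (ratWeylOperatorEquiv Φ hQ hη hkt').symm y with hz
  have hy : ratWeylOperator Φ hQ hη k t z = y := by
    rw [← coe_ratWeylOperatorEquiv Φ hQ hη hkt', LinearEquiv.coe_coe, hz, LinearEquiv.apply_symm_apply]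
  conv_lhs => rw [← hy]
  exact weylPolarizationForm_ratWeylOperator Φ hQ hη e htk hkt x z

/-- The same with `w⁻¹` spelled out: **`Q_w(w x, y) = (−1)^{|k−g|} Q_w(x, w y)`**. [cite: Andre1996Motifs, §1.2 Prop. 1.2 (p. 11)] [cite: Beauville2010SL2, §4 Theorem] -/
theorem weylPolarizationForm_ratWeylOperator_left' (hQ : η ∈ neronSeveriQ Φ) (hη : ∀ v : E, v ≠ 0 → ∃ w : E, η ![v, w] ≠ 0) {g : ℕ} (e : Fin (2 * g) ≃ ι) {k t : ℕ}
    (htk : t + k = 2 * g) (hkt : k + t = 2 * g) (x : rationalForms Φ k) (y : rationalForms Φ t) :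
    weylPolarizationForm Φ hQ hη e hkt (ratWeylOperator Φ hQ hη k t x) y =
      ((-1 : ℚ) ^ ((k : ℤ) - (g : ℤ)).natAbs) * weylPolarizationForm Φ hQ hη e htk x (ratWeylOperator Φ hQ hη t k y) := by
  have hg : finrank ℂ E = g := finrank_eq_of_finTwoMulEquiv Φ e
  rw [weylPolarizationForm_ratWeylOperator_left Φ hQ hη e htk hkt (by omega) x y, ratWeylOperatorEquiv_symm_apply, map_smul, smul_eq_mul, hg]

end Rational


/-! ## §4 The Lefschetz–Künneth projectors `π_{s,r}` are self-adjoint for `B` and for `Q_w` (appended, row g48-#9) -/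

section Projectors

include hη in
/-- **`B(π_{s,r} x, y) = B(x, π_{s,r} y)` IN EVERY DEGREE `s ≤ 2g`** (`x, y ∈ Hˢ(X; ℂ)`, `t + s = 2g`, `r` in Milne's range of `Hˢ`): Kleiman's projector `π_{s,r}` of `Hˢ` onto
`Lʳ P^{s−2r}` — the cohomological realisation of Künnemann's `e_{s,r}` — is SELF-ADJOINT FOR THE WEYL PAIRING: `w π_{s,r} = π_{t,r'} w` (`r + g = r' + s`,
`weylOperator_of_primitiveProj_apply`) and `π_{t,r'}` is the cup-product adjoint of `π_{s,r}` (`wedge_primitiveProj_eq_primitiveProj_wedge` /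
`primitiveProj_wedge_eq_wedge_primitiveProj`, below resp. above the middle degree). In André's matrix algebras the `π` are diagonal idempotents, hence symmetric.
[cite: Andre1996Motifs, §1.1 Lemme 1.1, §1.2 Prop. 1.2 (p. 11)] [cite: VoisinHodgeI2002, §6.3.2 Lemma 6.31 (PDF p. 128)] [cite: Kleiman1968AlgebraicCycles, §1.4] -/
theorem weylPairing_primitiveProj_left {g : ℕ} (e : Fin (2 * g) ≃ ι) {s t : ℕ} (hts : t + s = 2 * g) {r : ℕ} (hr : r ∈ lefschetzRange g s)
    (x y : E [⋀^Fin s]→L[ℝ] ℂ) :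
    weylPairing Φ hη e hts (primitiveProj η s r x) y = weylPairing Φ hη e hts x (primitiveProj η s r y) := by
  have hg : finrank ℂ E = g := finrank_eq_of_finTwoMulEquiv Φ e
  obtain ⟨hr₁, hr₂⟩ := mem_lefschetzRange.1 hr
  rw [weylPairing_apply, weylPairing_apply]
  rcases le_total s g with hs | hs
  · -- below the middle: `w π_{s,r} = π_{t,j+r} w`, `s + j = g`, and `π_{t,j+r}` is the cup-product adjoint of `π_{s,r}`
    obtain ⟨j, hj⟩ : ∃ j, s + j = g := ⟨g - s, by omega⟩
    rw [weylOperator_of_primitiveProj_apply hη (by omega) (by rwa [hg]) (show r + finrank ℂ E = (j + r) + s by omega) x,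
      ← wedge_primitiveProj_eq_primitiveProj_wedge hη (by omega) (show 2 * j + s = t by omega) r y]
  · -- above the middle: `w π_{s,r} = π_{t,r−j} w`, `t + j = g`, and `π_{s,r} = π_{s,j+(r−j)}` is the cup-product adjoint of `π_{t,r−j}`
    obtain ⟨j, hj⟩ : ∃ j, t + j = g := ⟨g - t, by omega⟩
    obtain ⟨r', hr'⟩ : ∃ r', j + r' = r := ⟨r - j, by omega⟩
    rw [weylOperator_of_primitiveProj_apply hη (by omega) (by rwa [hg]) (show r + finrank ℂ E = r' + s by omega) x,
      primitiveProj_wedge_eq_wedge_primitiveProj hη (by omega) (show 2 * j + t = s by omega) r', hr']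

/-- **`Q_w(π_{s,r} x, y) = Q_w(x, π_{s,r} y)` on `Hˢ(X, ℚ)`** (`η ∈ NS(X)` non-degenerate; `π_{s,r}` preserves `Hˢ(X, ℚ)`, `primitiveProj_apply_mem_rationalForms`): the rational
Lefschetz–Künneth projectors are self-adjoint for the Weyl polarization form — so the rational Lefschetz decomposition `Hˢ(X, ℚ) = ⊕_r Lʳ H^{s−2r}(X, ℚ)_prim` is
`Q_w`-orthogonal in every degree (compare `IsRiemannForm.weylPolarization_form_eq_zero_of_ne`, `s ≤ g`). [cite: Andre1996Motifs, §1.2 Prop. 1.2 (p. 11)]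
[cite: VoisinHodgeI2002, §6.3.2 Lemma 6.31 (PDF p. 128); §7.1.2 Def. 7.7 (PDF p. 134)] -/
theorem IsNSForm.weylPolarizationForm_primitiveProj_left (hNS : IsNSForm Φ η) (hη : ∀ v : E, v ≠ 0 → ∃ w : E, η ![v, w] ≠ 0) {g : ℕ} (e : Fin (2 * g) ≃ ι) {s t : ℕ}
    (hts : t + s = 2 * g) {r : ℕ} (hr : r ∈ lefschetzRange g s) (x y : rationalForms Φ s) :
    weylPolarizationForm Φ (mem_neronSeveriQ_of_isNSForm Φ hNS) hη e hts
        ⟨primitiveProj η s r (x : E [⋀^Fin s]→L[ℝ] ℂ), primitiveProj_apply_mem_rationalForms Φ hNS hη r x.2⟩ y =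
      weylPolarizationForm Φ (mem_neronSeveriQ_of_isNSForm Φ hNS) hη e hts x
        ⟨primitiveProj η s r (y : E [⋀^Fin s]→L[ℝ] ℂ), primitiveProj_apply_mem_rationalForms Φ hNS hη r y.2⟩ := by
  apply Rat.cast_injective (α := ℂ)
  rw [coe_weylPolarizationForm, coe_weylPolarizationForm, Submodule.coe_mk, Submodule.coe_mk, weylPairing_primitiveProj_left Φ hη e hts hr]

end Projectors

end ComplexTorus

end Literature.Geometry.Kaehler

end
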